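import Literature.Computability.Complexity.InteractiveProofs
import Literature.Computability.Complexity.PrivateCoinGames
import HarnessLib

/-!
# Private-coin games: the bridge to `IPVerifier.acceptProb`

Trunk T-CPLX-CORE, joins `InteractiveProofs.lean` (Arora–Barak Def. 8.6 over the tree's machine
classes: `IPVerifier`, `IPProver`, `transcript`, `Accepts`, `acceptProb`, `Proves`, `IPk`) to the
information-theoretic layer `PrivateCoinGames.lean` (`PCGame`, `opt`). For a verifier `V` and an
input `x`:

* `IPVerifier.toGame V x` — its game: coins `{0,1}^{coins |x|}` and messages `{0,1}^{msgLen |x|}` as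
  `List.Vector`s, `next` = the verifier's next-message function on its view, normalised by
  `List.takeD` exactly as the interaction does, verdict = the view lies in `verdict`;
* `IPVerifier.toStrategy` — the game strategy of an `IPProver` (replies normalised likewise);
* `transcriptAux_eq_play`, `transcript_eq_transcript_toGame`, `accepts_iff_toGame` — the
  interaction IS the play of the game;
* `acceptProb_eq_card_toGame` — `Pr_r[V accepts against P] = #{r | the game accepts} / 2^c`;
* `acceptProb_le_opt` — **for every prover, `Pr[accept] ≤ opt k [] / 2^c`**; so the soundness
  clause of `Proves` follows from the single inequality `3 · opt k [] ≤ 2^c`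
  (`acceptProb_le_third_of_opt`), to be established by the combinatorial analysis of the game.

Nothing here is specific to any protocol; written for the bottom-up discharge plan of
`Literature.Barriers.PneNP.AkaviaEtAl2006_complMemIPk` (and usable verbatim for
`GoldwasserSipser1986_IPk_subset_AMk`). All proved.

## References

* [AroraBarakCC2009] S. Arora, B. Barak, *Computational Complexity: A Modern Approach*, CUP 2009,
  §8.1, Def. 8.6.
-/

namespace Literature.Computability.Complexity

open Finset

namespace IPVerifier

variable (V : IPVerifier) (x : List Bool)

/-- **The game of a verifier on one input.** Coins are the bit vectors of length `coins(|x|)`,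
messages the bit vectors of length `msgLen(|x|)` (all messages are normalised to that length,
`length_eq_of_mem_transcript`); the verifier's message is `next` applied to its view, truncated /
padded by `List.takeD` exactly as in `transcriptAux`; the verdict is membership of the final view
in `verdict`. [cite: AroraBarakCC2009, Def. 8.6] -/
def toGame : PCGame (List.Vector Bool (V.coins.eval x.length))
    (List.Vector Bool (V.msgLen.eval x.length)) where
  next r h := ⟨(V.next (view x r.toList (h.map List.Vector.toList))).takeD
      (V.msgLen.eval x.length) false, List.takeD_length _ _ _⟩
  accept r h := view x r.toList (h.map List.Vector.toList) ∈ V.verdict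

/-- **The strategy of a prover**, its replies normalised to the message length (as the
interaction does anyway). [cite: AroraBarakCC2009, Def. 8.6] -/
def toStrategy (m : ℕ) (P : IPProver) : List (List.Vector Bool m) → List.Vector Bool m :=
  fun h => ⟨(P (h.map List.Vector.toList)).takeD m false, List.takeD_length _ _ _⟩

/-- The interaction of `InteractiveProofs.lean` IS the play of the game: continuing a transcript
of vectors for `n` messages (flag = "verifier to move" = even length) gives the game's play, read
back as lists. [cite: AroraBarakCC2009, Def. 8.6] -/
theorem transcriptAux_eq_play (r : List.Vector Bool (V.coins.eval x.length)) (P : IPProver)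
    (n : ℕ) (t : List (List.Vector Bool (V.msgLen.eval x.length))) (b : Bool)
    (hb : b = decide (Even t.length)) :
    V.transcriptAux x r.toList P (V.msgLen.eval x.length) b n (t.map List.Vector.toList) =
      ((V.toGame x).play r (toStrategy _ P) n t).map List.Vector.toList := by
  induction n generalizing t b with
  | zero => cases b <;> rfl
  | succ n ih =>
    have hsucc : Even (t.length + 1) ↔ ¬ Even t.length := Nat.even_add_one
    cases b with
    | true =>
      have he : Even t.length := by simpa using hb
      rw [PCGame.play_succ, if_pos he]
      have := ih (t ++ [(V.toGame x).next r t]) false (by simp [hsucc, he])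
      rw [List.map_append, List.map_singleton] at this
      exact this
    | false =>
      have he : ¬ Even t.length := by simpa using hb
      rw [PCGame.play_succ, if_neg he]
      have := ih (t ++ [toStrategy _ P t]) true (by simp [hsucc, he])
      rw [List.map_append, List.map_singleton] at this
      exact this

/-- The `k`-message transcript is the game's transcript. [cite: AroraBarakCC2009, Def. 8.6] -/
theorem transcript_eq_transcript_toGame (k : ℕ) (r : List.Vector Bool (V.coins.eval x.length))
    (P : IPProver) :
    V.transcript k x r.toList P =
      ((V.toGame x).transcript k r (toStrategy _ P)).map List.Vector.toList := by
  have h := V.transcriptAux_eq_play x r P k [] true (by simp)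
  simpa [transcript, PCGame.transcript] using h

/-- Acceptance of the interaction is acceptance in the game. [cite: AroraBarakCC2009, Def. 8.6] -/
theorem accepts_iff_toGame (k : ℕ) (r : List.Vector Bool (V.coins.eval x.length)) (P : IPProver) :
    V.Accepts k x r.toList P ↔
      (V.toGame x).accept r ((V.toGame x).transcript k r (toStrategy _ P)) := by
  simp only [Accepts, transcript_eq_transcript_toGame]
  rfl

open scoped Classical in
/-- **The acceptance probability is a game count**: `Pr_r[V accepts] = #{r | game accepts} / 2^c`.
[cite: AroraBarakCC2009, Def. 8.6] -/
theorem acceptProb_eq_card_toGame (k : ℕ) (P : IPProver) :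
    V.acceptProb k x P =
      ((univ.filter fun r : List.Vector Bool (V.coins.eval x.length) =>
        (V.toGame x).accept r ((V.toGame x).transcript k r (toStrategy _ P))).card : ℝ) /
        2 ^ (V.coins.eval x.length) := by
  unfold acceptProb uniformProb
  congr 2
  refine Finset.card_bij (fun r _ => r) (fun r hr => ?_) (fun _ _ _ _ h => h) (fun r hr => ⟨r, ?_, rfl⟩)
  · rw [mem_filter] at hr ⊢
    exact ⟨hr.1, (V.accepts_iff_toGame x k r P).1 hr.2⟩
  · rw [mem_filter] at hr ⊢
    exact ⟨hr.1, (V.accepts_iff_toGame x k r P).2 hr.2⟩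

open scoped Classical in
/-- **Soundness against all provers from one number**: for EVERY prover,
`Pr_r[V accepts] ≤ opt k [] / 2^c`, where `opt` is the backward-induction value of the verifier's
game on `x` (`PCGame.card_accept_transcript_le_opt`). [cite: AroraBarakCC2009, Def. 8.6] -/
theorem acceptProb_le_opt (k : ℕ) (P : IPProver) :
    V.acceptProb k x P ≤ ((V.toGame x).opt k [] : ℝ) / 2 ^ (V.coins.eval x.length) := by
  rw [acceptProb_eq_card_toGame]
  exact div_le_div_of_nonneg_right
    (by exact_mod_cast (V.toGame x).card_accept_transcript_le_opt (toStrategy _ P) k)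
    (by positivity)

open scoped Classical in
/-- The soundness clause of `Proves` from the game value: if `3 · opt k [] ≤ 2^c` then every prover
is accepted with probability at most `1/3`. [cite: AroraBarakCC2009, Def. 8.6] -/
theorem acceptProb_le_third_of_opt (k : ℕ)
    (h : 3 * (V.toGame x).opt k [] ≤ 2 ^ (V.coins.eval x.length)) (P : IPProver) :
    V.acceptProb k x P ≤ 1 / 3 := by
  refine (V.acceptProb_le_opt x k P).trans ?_
  rw [div_le_div_iff₀ (by positivity) (by norm_num)]
  have : (3 : ℝ) * (V.toGame x).opt k [] ≤ 2 ^ (V.coins.eval x.length) := by exact_mod_cast h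
  linarith

end IPVerifier

end Literature.Computability.Complexity
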